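import Mathlib
import Summits.Ventures.HodgeRepro.Tier4.Line4.SublevelCountBase
import Summits.Ventures.HodgeRepro.Tier4.Line4.LatticeVolume
import Summits.Ventures.HodgeRepro.Tier4.Line4.ArchDistBounds
import Summits.Ventures.HodgeRepro.Tier4.Line4.FinitePlacePositivity
import Summits.Ventures.HodgeRepro.Tier4.Line4.TorusProduct
import Summits.Ventures.HodgeRepro.Tier4.Line1.LocallyCompactGA

/-!
# Tier4/Line4/SublevelOfVolume — the sublevel lattice count at the identity from the VOLUME GROWTH of the sublevel sets
(the packing argument): display (8) collapses to one ball-volume display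

Blind re-derivation cell `pub-hodge-repro`, Tier 4 «prove the step» (README §9–§10), seat t4-L4-p2 (prover, LINE L4,
gen 4; cut C-L4-SUBLEVEL₀, plan-4 g5 S15269, statement S15271).  Tree path
`lean/Summits/Ventures/HodgeRepro/Tier4/Line4/SublevelOfVolume.lean`.  One `def … : Prop` (the display); no literature.

`VolumeGrowth W S`: for every compact `Kf' ⊆ G(𝔸_f)` there are `C ≥ 0` and `α < 3` with
`μ{g : g_f ∈ Kf', archDist g ≤ T} ≤ C e^{αT}` for all `T` — the Haar volume of the archimedean `archDist`-ball times the
volume of `Kf'` (at the indefinite real place the group is `SO(2,2)` / `SO(3,1)` and the ball `{‖g‖ ≤ e^T}` has volume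
`≍ e^{2T} T` resp. `≍ e^{2T}`; compact at every other place; the Poincaré series of weight `3 > 2 + ε` converge).  A
PRINT-shaped SUPPORT display; no proof claimed.

`sublevelCount₀_of_volumeGrowth`: `VolumeGrowth W S → SublevelCount₀ W S` by PACKING.  Take the separating, relatively
compact open `U ∋ 1` of LatticeVolume (`U U⁻¹ ∩ G(k) = {1}`, `G(𝔸)` locally compact) and `c := sup_{closure U} archDist`.  A
rational point `γ` with `γ_f ∈ Kf` and `archDist γ ≤ T` has `γ U ⊆ K′ := {g : g_f ∈ Kf · (closure U)_f, archDist g ≤ T + c}`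
(`ofFinPart` is a homomorphism, `archDist` is subadditive), the translates `γ U` are pairwise disjoint, so
`#{γ} · μ(U) ≤ μ(K′) ≤ C e^{α(T + c)}` (`card_mul_measure_le_of_separating`) — every finite set of such `γ` has at most
`C e^{α(T+c)} / μ(U)` elements, the set is finite, and the bound holds with the constant `C e^{αc} / μ(U)` and the SAME
exponent `α`.  With `sublevelCount_of_sublevelCount₀` and `poincareOfDecay_of_sublevelCount`, display (8) of the L4
skeleton is «closed modulo `VolumeGrowth`», and the same count is the `hcount` of the level-measure tail assembly.

Nothing here says anything about the status of the Hodge conjecture for CM abelian varieties, which is NOT proved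
(HC_CM is NOT proved by anyone in this repository).
-/

set_option autoImplicit false

noncomputable section

namespace Summit.Ventures.HodgeRepro.Tier4.Line4

open Summit.Ventures.HodgeRepro.Tier4.Common Summit.Ventures.HodgeRepro.Tier4.Line1
  Summit.Ventures.HodgeRepro.Tier4.Line1.RTF Summit.Ventures.HodgeRepro.Tier4.Line4.L1Class MeasureTheory NumberField

open scoped Pointwise ENNReal

variable {k : Type} [Field k] [NumberField k] (W : PlaneData k) [MeasurableSpace (GA W)] [BorelSpace (GA W)]

omit [BorelSpace (GA W)] in
/-- **DISPLAY — the volume growth of the sublevel sets**: for every compact `Kf' ⊆ G(𝔸_f)`, `μ{g : g_f ∈ Kf', archDist g ≤ T}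
≤ C e^{αT}` with `α < 3` (the archimedean ball volume `≍ e^{2T} T` at the indefinite real place, times `μ_f(Kf')`). -/
def VolumeGrowth (S : RTF.Setting (GA W)) : Prop :=
  ∀ Kf' : Set (GA W), IsCompact Kf' → Kf' ⊆ (finitePart W : Set (GA W)) →
    ∃ C α : ℝ, 0 ≤ C ∧ α < 3 ∧ ∀ T : ℝ,
      S.μ {g : GA W | GA.ofFinPart W g ∈ Kf' ∧ archDist W g ≤ T} ≤ ENNReal.ofReal (C * Real.exp (α * T))

/-- **The sublevel lattice count from the volume growth** (packing): `VolumeGrowth W S → SublevelCount₀ W S`. -/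
theorem sublevelCount₀_of_volumeGrowth (S : RTF.Setting (GA W)) (hV : VolumeGrowth W S) : SublevelCount₀ W S := by
  intro Kf hKf hKfin
  haveI : LocallyCompactSpace (GA W) := locallyCompact_GA W
  haveI := S.haar
  obtain ⟨U, hUo, hU1, hUc, hUsep⟩ := exists_isOpen_separating_isCompact_closure S
  have hUfin : S.μ U ≠ ∞ := ne_of_lt ((measure_mono subset_closure).trans_lt hUc.measure_lt_top)
  have hUpos : 0 < S.μ.real U := by
    rw [measureReal_def]
    exact ENNReal.toReal_pos (hUo.measure_pos S.μ ⟨1, hU1⟩).ne' hUfin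
  obtain ⟨c, hc⟩ := exists_archDist_le_of_isCompact W (closure U) hUc
  -- the enlarged compact of the finite part
  have hKf'c : IsCompact (Kf * (GA.ofFinPart W '' closure U)) := hKf.mul (hUc.image (continuous_ofFinPart W))
  have hKf'fin : Kf * (GA.ofFinPart W '' closure U) ⊆ (finitePart W : Set (GA W)) := by
    rintro _ ⟨a, ha, _, ⟨u, _, rfl⟩, rfl⟩
    exact Subgroup.mul_mem _ (hKfin ha) (ofFinPart_mem_finitePart W u)
  obtain ⟨C, α, hC0, hα, hvol⟩ := hV _ hKf'c hKf'fin
  -- the packing bound for every finite set of sublevel rational points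
  have key : ∀ (T : ℝ) (F : Finset S.Gk),
      (∀ γ ∈ F, GA.ofFinPart W (γ : GA W) ∈ Kf ∧ archDist W (γ : GA W) ≤ T) →
      (F.card : ℝ) * S.μ.real U ≤ C * Real.exp (α * (T + c)) := by
    intro T F hF
    have h1 := card_mul_measure_le_of_separating S hUo hUsep
      {g : GA W | GA.ofFinPart W g ∈ Kf ∧ archDist W g ≤ T} 1 F (fun γ hγ => by simpa using hF γ hγ)
    have hsub : {g : GA W | GA.ofFinPart W g ∈ Kf ∧ archDist W g ≤ T} * U ⊆
        {g : GA W | GA.ofFinPart W g ∈ Kf * (GA.ofFinPart W '' closure U) ∧ archDist W g ≤ T + c} := by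
      rintro _ ⟨g, hg, u, hu, rfl⟩
      refine ⟨?_, ?_⟩
      · rw [ofFinPart_mul]
        exact Set.mul_mem_mul hg.1 ⟨u, subset_closure hu, rfl⟩
      · exact (archDist_mul_le W g u).trans (add_le_add hg.2 (hc u (subset_closure hu)))
    have h2 : (F.card : ℝ≥0∞) * S.μ U ≤ ENNReal.ofReal (C * Real.exp (α * (T + c))) :=
      h1.trans ((measure_mono hsub).trans (hvol (T + c)))
    have h3 := ENNReal.toReal_mono ENNReal.ofReal_ne_top h2
    rw [ENNReal.toReal_mul, ENNReal.toReal_natCast, ENNReal.toReal_ofReal (by positivity)] at h3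
    simpa [measureReal_def] using h3
  refine ⟨C * Real.exp (α * c) / S.μ.real U, α, by positivity, hα, fun T => ?_⟩
  -- the sublevel set is finite
  have hfin : {γ : S.Gk | GA.ofFinPart W (γ : GA W) ∈ Kf ∧ archDist W (γ : GA W) ≤ T}.Finite := by
    by_contra hinf
    obtain ⟨F, hFsub, hFcard⟩ := (Set.not_finite.mp hinf).exists_subset_card_eq
      (⌈C * Real.exp (α * (T + c)) / S.μ.real U⌉₊ + 1)
    have h := key T F fun γ hγ => hFsub hγ
    rw [hFcard] at h
    have h4 : ((⌈C * Real.exp (α * (T + c)) / S.μ.real U⌉₊ + 1 : ℕ) : ℝ) ≤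
        C * Real.exp (α * (T + c)) / S.μ.real U := by
      rwa [le_div_iff₀ hUpos]
    have h5 := Nat.le_ceil (C * Real.exp (α * (T + c)) / S.μ.real U)
    push_cast at h4
    linarith
  refine ⟨hfin.toFinset, fun γ h1 h2 => hfin.mem_toFinset.mpr ⟨h1, h2⟩, ?_⟩
  have h := key T hfin.toFinset fun γ hγ => hfin.mem_toFinset.mp hγ
  rw [div_mul_eq_mul_div, le_div_iff₀ hUpos]
  calc (hfin.toFinset.card : ℝ) * S.μ.real U ≤ C * Real.exp (α * (T + c)) := h
    _ = C * Real.exp (α * c) * Real.exp (α * T) := by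
      rw [mul_add, Real.exp_add]
      ring

end Summit.Ventures.HodgeRepro.Tier4.Line4

end
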